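import Literature.AlgebraicGeometry.Motives.HodgeThetaSubalgebraUnitaryFiveCore
import HarnessLib

/-!
# The `Θ`-subalgebra theorem for unitary multiplicities `(7, 13)` — complex–Hermitian core
# (Ribet 1983, Thm. 3 at `(n′, n″) = (7, 13)`: twentyfolds; the last pair in the closure of the tree's three raising-rank lemmas)

Family `hodge`, layer `Literature/AlgebraicGeometry/Motives` (pure linear algebra over `ℂ`; no geometry). Research
context: cell `pub-hodge-ring2` (HONEST FRAMING: research route conditional on HC_CM; not a corollary; Q11.4-sentence-2
already refuted in dim ≥ 3), Literature lane gen 83, programme R65. UNCONDITIONAL; theorems only, no definition, no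
named fact (D-0026), no `sorry`. The rank-SEVEN raising lemma at `dim Q = 13`: ranks `2 → 3 → 4 → 5 → 6` by the Ψ-core
route (`exists_raise_rank_gt_of_psi_core` with the cores `(5|2)`, `(4|3)`, `(3|4)`, `(2|5)` — all pairs summing to the
prime `7`), rank `6 → 7` by the Φ-route with the `(6|7)` core (`UnitaryCoprimeStep.eq_top_six_seven`); then the Levi step
`(7|6)` (`eq_top_seven_six`). This is the only pair with `min(n′, n″) ≥ 6` other than `(6,7)` that the three lemmas reach
(README of the unit, closure computation).

## References
* [Ribet1983] K. A. Ribet, Amer. J. Math. 105 (1983), Thm. 3.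
* [Gordon1997] B. B. Gordon, *A survey of the Hodge conjecture for abelian varieties*, Thm. 6.3 (3), pp. 18–19.
* [Deligne1982HodgeCycles] P. Deligne, LNM 900 (1982), I §3 Prop. 3.4, 3.6.
-/

noncomputable section

namespace Literature.AlgebraicGeometry.Motives

namespace HodgeStructure

section RankSeven

universe u

variable {W : Type u} [AddCommGroup W] [Module ℂ W]

/-- **The rank-seven raising lemma at `(7, 13)`.** [cite: Ribet1983, Thm. 3] [cite: Gordon1997, Thm. 6.3 (3)]
[cite: Deligne1982HodgeCycles, I §3 Prop. 3.6] -/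
theorem UnitarySeven.exists_raise_onto_seven_thirteen [FiniteDimensional ℂ W] {𝔊 : Submodule ℂ (Module.End ℂ W)}
    (hbr : ∀ Y ∈ 𝔊, ∀ Z ∈ 𝔊, Y * Z - Z * Y ∈ 𝔊)
    (hirr : ∀ U : Submodule ℂ W, (∀ A ∈ 𝔊, ∀ u ∈ U, A u ∈ U) → U = ⊥ ∨ U = ⊤)
    {Θ : Module.End ℂ W} (hΘ : Θ ∈ 𝔊) (hΘΘ : Θ * Θ = 1)
    {P Q : Submodule ℂ W} (hP : ∀ x, x ∈ P ↔ Θ x = x) (hQ : ∀ x, x ∈ Q ↔ Θ x = -x)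
    (hP7 : Module.finrank ℂ P = 7) (hQ13 : Module.finrank ℂ Q = 13)
    {s : W → W → ℂ} (hadd : ∀ x y z, s (x + y) z = s x z + s y z) (hsymm : ∀ x y, s y x = starRingEnd ℂ (s x y))
    (hPQ : ∀ p ∈ P, ∀ q ∈ Q, s p q = 0) (hdefP : ∀ p ∈ P, s p p = 0 → p = 0) (hdefQ : ∀ q ∈ Q, s q q = 0 → q = 0)
    (hadj : ∀ X ∈ 𝔊, ∃ Y ∈ 𝔊, ∀ x y, s (X x) y = s x (Y y)) :
    ∃ B ∈ 𝔊, Θ * B = B ∧ B * Θ = -B ∧ ∀ p ∈ P, ∃ w, B w = p := by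
  classical
  have hraiseval : ∀ Z : Module.End ℂ W, Θ * Z = Z → ∀ w, Z w ∈ P := fun Z hΘZ w =>
    (hP _).2 (by rw [← Module.End.mul_apply, hΘZ])
  have hle7 : ∀ B' : Module.End ℂ W, Θ * B' = B' → Module.finrank ℂ (LinearMap.range B') ≤ 7 := fun B' h => by
    rw [← hP7]
    exact Submodule.finrank_mono (by rintro _ ⟨w, rfl⟩; exact hraiseval B' h w)
  have honto : ∀ B' : Module.End ℂ W, Θ * B' = B' → 7 ≤ Module.finrank ℂ (LinearMap.range B') →
      ∀ p ∈ P, ∃ w, B' w = p := by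
    intro B' hΘB' h7 p hp
    have hle : LinearMap.range B' ≤ P := by rintro _ ⟨w, rfl⟩; exact hraiseval B' hΘB' w
    have heq : LinearMap.range B' = P := Submodule.eq_of_le_of_finrank_le hle (by rw [hP7]; exact h7)
    have hp' : p ∈ LinearMap.range B' := heq ▸ hp
    exact hp'
  have hup : ∀ B' ∈ 𝔊, Θ * B' = B' → B' * Θ = -B' →
      2 ≤ Module.finrank ℂ (LinearMap.range B') → Module.finrank ℂ (LinearMap.range B') ≤ 6 →
      ∃ B'' ∈ 𝔊, Θ * B'' = B'' ∧ B'' * Θ = -B'' ∧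
        Module.finrank ℂ (LinearMap.range B') < Module.finrank ℂ (LinearMap.range B'') := by
    intro B' hB' hΘB' hB'Θ h2 h6
    by_cases hr6 : Module.finrank ℂ (LinearMap.range B') = 6
    · -- Φ-route with the `(6 | 7)` core
      refine UnitaryRaisingRank.exists_raise_rank_gt_of_two_le hbr hirr hΘ hΘΘ hP hQ hadd hsymm hPQ hdefP hdefQ
        hadj hB' hΘB' hB'Θ (by omega) (by omega) (by omega) fun U 𝔩 ι P' Q' hbr𝔩 hirr𝔩 hι hιι hP' hQ' hfinP' hfinQ'
          hP'Q' hdefP' hdefQ' hadj𝔩 => ?_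
      exact UnitaryCoprimeStep.eq_top_six_seven hbr𝔩 hirr𝔩 hι hιι hP' hQ' (by rw [hfinP', hr6]) (by omega)
        (s := fun x y : U => s (x : W) y) (fun x y z => by simp only [Submodule.coe_add, hadd])
          (fun x y => hsymm x y) hP'Q' hdefP' hdefQ' hadj𝔩
    · -- ranks `2, …, 5`: Ψ-route with the cores `(5|2)`, `(4|3)`, `(3|4)`, `(2|5)`
      refine UnitaryRaisingRank.exists_raise_rank_gt_of_psi_core hbr hirr hΘ hΘΘ hP hQ hB' hΘB' hB'Θ (by omega)
        (by omega) (by omega) hadd hsymm hPQ hdefP hdefQ hadj fun U 𝔩 ι P' Q' hbr𝔩 hirr𝔩 hι hιι hP' hQ' hfinP' hfinQ'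
          hP'Q' hdefP' hdefQ' hadj𝔩 => ?_
      by_cases hr2 : Module.finrank ℂ (LinearMap.range B') = 2
      · exact UnitaryTwoOdd.eq_top' hbr𝔩 hirr𝔩 hι hιι hP' hQ' ⟨2, by omega⟩ (by rw [hfinQ', hr2])
          (s := fun x y : U => s (x : W) y) (fun x y z => by simp only [Submodule.coe_add, hadd])
          (fun x y => hsymm x y) hP'Q' hdefP' hdefQ' hadj𝔩
      by_cases hr3 : Module.finrank ℂ (LinearMap.range B') = 3
      · exact UnitaryFourOdd.eq_top hbr𝔩 hirr𝔩 hι hιι hP' hQ' (by omega) (by rw [hfinQ', hr3]; exact ⟨1, rfl⟩)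
          (s := fun x y : U => s (x : W) y) (fun x y z => by simp only [Submodule.coe_add, hadd])
          (fun x y => hsymm x y) hP'Q' hdefP' hdefQ' hadj𝔩
      by_cases hr4 : Module.finrank ℂ (LinearMap.range B') = 4
      · exact UnitaryThreeCoprime.eq_top hbr𝔩 hirr𝔩 hι hιι hP' hQ' (by omega) (by rw [hfinQ', hr4]; omega)
          (s := fun x y : U => s (x : W) y) (fun x y z => by simp only [Submodule.coe_add, hadd])
          (fun x y => hsymm x y) hP'Q' hdefP' hdefQ' hadj𝔩
      · have hr5 : Module.finrank ℂ (LinearMap.range B') = 5 := by omega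
        exact UnitaryTwoOdd.eq_top hbr𝔩 hirr𝔩 hι hιι hP' hQ' (by omega) (by rw [hfinQ', hr5]; exact ⟨2, rfl⟩)
          (s := fun x y : U => s (x : W) y) (fun x y z => by simp only [Submodule.coe_add, hadd])
          (fun x y => hsymm x y) hP'Q' hdefP' hdefQ' hadj𝔩
  -- climb `2 → … → 7`
  have hclimb : ∀ n : ℕ, ∀ B' ∈ 𝔊, Θ * B' = B' → B' * Θ = -B' → 2 ≤ Module.finrank ℂ (LinearMap.range B') →
      n + Module.finrank ℂ (LinearMap.range B') ≥ 7 →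
      ∃ B'' ∈ 𝔊, Θ * B'' = B'' ∧ B'' * Θ = -B'' ∧ 7 ≤ Module.finrank ℂ (LinearMap.range B'') := by
    intro n
    induction n with
    | zero =>
      intro B' hB' hΘB' hB'Θ _ h7
      exact ⟨B', hB', hΘB', hB'Θ, by omega⟩
    | succ n ih =>
      intro B' hB' hΘB' hB'Θ h2 h7
      by_cases h7' : 7 ≤ Module.finrank ℂ (LinearMap.range B')
      · exact ⟨B', hB', hΘB', hB'Θ, h7'⟩
      obtain ⟨B'', hB'', hΘB'', hB''Θ, hlt⟩ := hup B' hB' hΘB' hB'Θ h2 (by omega)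
      exact ih B'' hB'' hΘB'' hB''Θ (by omega) (by omega)
  obtain ⟨B₂, hB₂, hΘB₂, hB₂Θ, hrk₂⟩ :=
    UnitaryThreeCoprime.exists_raise_rank_ge_two hbr hirr hΘ hΘΘ hP hQ (by omega) (by omega)
  obtain ⟨B₇, hB₇, hΘB₇, hB₇Θ, h7⟩ := hclimb 5 B₂ hB₂ hΘB₂ hB₂Θ hrk₂ (by omega)
  exact ⟨B₇, hB₇, hΘB₇, hB₇Θ, honto B₇ hΘB₇ h7⟩

end RankSeven

/-! ### §2 The `(7 | 13)` core -/

section Main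

variable {W : Type*} [AddCommGroup W] [Module ℂ W]

/-- **THE `Θ`-SUBALGEBRA THEOREM FOR UNITARY MULTIPLICITIES `(7, 13)` — complex Hermitian core** (Ribet's Thm. 3 at
`(7, 13)`, classification-free). [cite: Ribet1983, Thm. 3] [cite: Gordon1997, Thm. 6.3 (3) and pp. 18–19]
[cite: Deligne1982HodgeCycles, I §3 Prop. 3.4, 3.6] -/
theorem UnitarySeven.eq_top_seven_thirteen [FiniteDimensional ℂ W] {𝔊 : Submodule ℂ (Module.End ℂ W)}
    (hbr : ∀ Y ∈ 𝔊, ∀ Z ∈ 𝔊, Y * Z - Z * Y ∈ 𝔊)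
    (hirr : ∀ U : Submodule ℂ W, (∀ A ∈ 𝔊, ∀ u ∈ U, A u ∈ U) → U = ⊥ ∨ U = ⊤)
    {Θ : Module.End ℂ W} (hΘ : Θ ∈ 𝔊) (hΘΘ : Θ * Θ = 1)
    {P Q : Submodule ℂ W} (hP : ∀ x, x ∈ P ↔ Θ x = x) (hQ : ∀ x, x ∈ Q ↔ Θ x = -x)
    (hP7 : Module.finrank ℂ P = 7) (hQ13 : Module.finrank ℂ Q = 13)
    {s : W → W → ℂ} (hadd : ∀ x y z, s (x + y) z = s x z + s y z) (hsymm : ∀ x y, s y x = starRingEnd ℂ (s x y))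
    (hPQ : ∀ p ∈ P, ∀ q ∈ Q, s p q = 0) (hdefP : ∀ p ∈ P, s p p = 0 → p = 0) (hdefQ : ∀ q ∈ Q, s q q = 0 → q = 0)
    (hadj : ∀ X ∈ 𝔊, ∃ Y ∈ 𝔊, ∀ x y, s (X x) y = s x (Y y)) : 𝔊 = ⊤ := by
  refine UnitaryCoprimeStep.eq_top_of_onto_of_core hbr hirr hΘ hΘΘ hP hQ hP7 hQ13 (by norm_num) (by norm_num) hadd
    hsymm hPQ hdefP hdefQ hadj ?_ ?_
  · exact UnitarySeven.exists_raise_onto_seven_thirteen hbr hirr hΘ hΘΘ hP hQ hP7 hQ13 hadd hsymm hPQ hdefP hdefQ hadj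
  · intro 𝔩 ι P' Q' hbr𝔩 hirr𝔩 hι hιι hP' hQ' hfinP' hfinQ' hP'Q' hdefP' hdefQ' hadj𝔩
    exact UnitaryCoprimeStep.eq_top_seven_six hbr𝔩 hirr𝔩 hι hιι hP' hQ' hfinP' (by rw [hfinQ']) (s := fun x y : Q => s (x : W) y)
      (fun x y z => by simp only [Submodule.coe_add, hadd]) (fun x y => hsymm x y) hP'Q' hdefP' hdefQ' hadj𝔩

/-- **The mirror `(13 | 7)`** (apply `eq_top_seven_thirteen` to `−Θ`). [cite: Ribet1983, Thm. 3]
[cite: Gordon1997, Thm. 6.3 (3)] -/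
theorem UnitarySeven.eq_top_thirteen_seven [FiniteDimensional ℂ W] {𝔊 : Submodule ℂ (Module.End ℂ W)}
    (hbr : ∀ Y ∈ 𝔊, ∀ Z ∈ 𝔊, Y * Z - Z * Y ∈ 𝔊)
    (hirr : ∀ U : Submodule ℂ W, (∀ A ∈ 𝔊, ∀ u ∈ U, A u ∈ U) → U = ⊥ ∨ U = ⊤)
    {Θ : Module.End ℂ W} (hΘ : Θ ∈ 𝔊) (hΘΘ : Θ * Θ = 1)
    {P Q : Submodule ℂ W} (hP : ∀ x, x ∈ P ↔ Θ x = x) (hQ : ∀ x, x ∈ Q ↔ Θ x = -x)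
    (hP13 : Module.finrank ℂ P = 13) (hQ7 : Module.finrank ℂ Q = 7)
    {s : W → W → ℂ} (hadd : ∀ x y z, s (x + y) z = s x z + s y z) (hsymm : ∀ x y, s y x = starRingEnd ℂ (s x y))
    (hPQ : ∀ p ∈ P, ∀ q ∈ Q, s p q = 0) (hdefP : ∀ p ∈ P, s p p = 0 → p = 0) (hdefQ : ∀ q ∈ Q, s q q = 0 → q = 0)
    (hadj : ∀ X ∈ 𝔊, ∃ Y ∈ 𝔊, ∀ x y, s (X x) y = s x (Y y)) : 𝔊 = ⊤ := by
  have hnΘ : -Θ ∈ 𝔊 := Submodule.neg_mem _ hΘ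
  have hnΘΘ : (-Θ) * (-Θ) = 1 := by rw [neg_mul_neg, hΘΘ]
  exact UnitarySeven.eq_top_seven_thirteen hbr hirr hnΘ hnΘΘ (P := Q) (Q := P)
    (fun x => by rw [hQ, LinearMap.neg_apply, neg_eq_iff_eq_neg]) (fun x => by rw [hP, LinearMap.neg_apply, neg_inj])
    hQ7 hP13 hadd hsymm (fun q hq p hp => by rw [hsymm, hPQ p hp q hq, map_zero]) hdefQ hdefP hadj

end Main

end HodgeStructure

end Literature.AlgebraicGeometry.Motives

end
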